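import Summits.QuantumFields.YangMills.Theorems.UnitScaleTiltProp7AvgLinearisationPlaqSmall
import Summits.QuantumFields.YangMills.Theorems.UnitScaleTiltBlockAvgCorrector
import HarnessLib

/-!
# Route `UnitScaleTilt`, crux K1 child «MinimiserStabilityRegPr» (stmt-QuantumFields-19200), leaf V3 `stub_prop7From14`, sub-lemma V3-C (one step,
# EXISTENCE FORM): near a small-plaquette background `U₀`, the fibre of the one-step (0.4)-average through `U₀` is a graph over the kernel of the
# LINEARISED constraint up to second order — [Balaban1985Variational] Sect. C (47) `A = A′ − HD(A′)`, `|D(A′)| ≤ 4C₂|A′|²` (Prop. 3 p. 289), at the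
# d = 3 carrier for one averaging step, with the correction carried by the central crossing bonds

Fleet seat `ym-ust-19200-p2` (gen 2), `--supports stmt-QuantumFields-19200`.  COMPOSITION ONLY: the EXACT CORRECTOR of the cell (`BlockAvgCorrector.exists_corrector_T3`,
p448916: a field whose (0.4)-average is within `η` of a target `V` is corrected ON THE CENTRAL BONDS to average EXACTLY to `V`, moving each bond by
`≤ Cη`, `C = 72L³`) fed with the defect supplied by the linearisation of the average at the background (`BlockAveragingEMLLinearisedBackground`, p484812∕p485608,
read from `PlaqSmall` in `UnitScaleTiltProp7AvgLinearisationPlaqSmall`): if `U = (1 + Y)U₀` bondwise with `‖Y_b‖ ≤ δ` and `Y` satisfies the LINEARISED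
constraint `Q₁^{R₀}(U₀)Y = 0` up to `ρ` at every coarse bond, then the average of `U` is within `η = 404·ℓδ·(ℓδ + (ℓ²/4)a) + ρ` of that of `U₀`, so some `U′`
with `Ū′ = Ū₀` EXACTLY lies within `Cη` of `U` bondwise and agrees with `U` off the central bonds — the one-step, d = 3 instance of print's chart
(47)–(48): «A = A′ − HD(A′) … |D(A′)| ≤ 4C₂|A′|²» in existence form (no explicit right inverse `H`; the corrector's Banach iteration plays its role).

WHAT IS PROVED (kernel, no `def`, no `sorry`): `norm_coe_sub_coe_eq_norm_pertVar` (`‖U_b − U₀,b‖ = ‖Y_b‖`), `dist1_plaqHol_le_add_of_pertVar`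
(plaquettes of `U` within `4δ` of those of `U₀`), `plaqSmall_of_pertVar`, `norm_avgFun_sub_avgFun_le` (the defect `η`), and
**`exists_fibre_point_near_of_linearised`** (the statement above, constants `t₀ = (3600(L+1)⁵)⁻¹`, `C = 72L³` of the corrector).

References: T. Bałaban, CMP 102 (1985) 277–309 [Balaban1985Variational] (Sect. C (43)–(48), Prop. 3 p.289); CMP 98 (1985) 17–51 [Balaban1985Averaging]
(Prop. 3 p.36); CMP 109 (1987) 249–301 [Balaban1987RG1] ((0.4) p.253).
-/

noncomputable section

namespace Summit.QuantumFields.YangMills.Theorems.Prop7AvgLinearisation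

open Literature.MathematicalPhysics.QuantumFieldTheory.Balaban1983to89
open T4Continuum BlockAveraging AveragingRT ExpMeanLog LatticeWordStokes BlockAveragingEMLLinearisedBackground T3ContinuumYM3Torus
open BlockAveragingHaarAC (centralBond)
open T3UnitLawDensityEML (ℰp)
open scoped Matrix.Norms.L2Operator

section Letters

variable {n : Type*} [Fintype n] [DecidableEq n] [Nonempty n] {P : Params} {j : ℕ}

omit [Nonempty n] in
/-- Elements of `SU(N)` are unitary matrices. [folklore] -/
private theorem coe_mem_unitaryGroup (g : Matrix.specialUnitaryGroup n ℂ) : (g : Matrix n n ℂ) ∈ Matrix.unitaryGroup n ℂ :=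
  (Matrix.mem_specialUnitaryGroup_iff.1 g.2).1

omit [Nonempty n] in
/-- **THE BONDS OF `U` ARE WITHIN `‖Y_b‖` OF THOSE OF `U₀`**: `‖U_b − U₀,b‖ = ‖Y_b‖` (`Y_b = U_bU₀,b⁻¹ − 1`; right multiplication by the unitary `U₀,b`).
[cite: Balaban1985Variational, (15) p.280] -/
theorem norm_coe_sub_coe_eq_norm_pertVar (U₀ U : GaugeField P j (Matrix.specialUnitaryGroup n ℂ)) (b : PBond P j) :
    ‖((U b : Matrix.specialUnitaryGroup n ℂ) : Matrix n n ℂ) - ((U₀ b : Matrix.specialUnitaryGroup n ℂ) : Matrix n n ℂ)‖ = ‖pertVar U₀ U b‖ := by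
  have hu : star ((U₀ b : Matrix.specialUnitaryGroup n ℂ) : Matrix n n ℂ) * ((U₀ b : Matrix.specialUnitaryGroup n ℂ) : Matrix n n ℂ) = 1 :=
    Unitary.star_mul_self_of_mem (coe_mem_unitaryGroup (U₀ b))
  have e : ((U b : Matrix.specialUnitaryGroup n ℂ) : Matrix n n ℂ) - ((U₀ b : Matrix.specialUnitaryGroup n ℂ) : Matrix n n ℂ) =
      pertVar U₀ U b * ((U₀ b : Matrix.specialUnitaryGroup n ℂ) : Matrix n n ℂ) := by
    rw [pertVar_eq, sub_mul, one_mul, mul_assoc, hu, mul_one]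
  rw [e, CStarRing.norm_mul_mem_unitary _ (coe_mem_unitaryGroup (U₀ b))]

omit [Nonempty n] in
/-- Four unit-norm factors: `‖f₁f₂f₃f₄ − g₁g₂g₃g₄‖ ≤ Σ‖fᵢ − gᵢ‖` when every `‖fᵢ‖, ‖gᵢ‖ ≤ 1`. [folklore] -/
private theorem norm_prod_four_sub_prod_four_le {f₁ f₂ f₃ f₄ g₁ g₂ g₃ g₄ : Matrix n n ℂ}
    (hf₁ : ‖f₁‖ ≤ 1) (hf₂ : ‖f₂‖ ≤ 1) (hf₃ : ‖f₃‖ ≤ 1) (hg₂ : ‖g₂‖ ≤ 1) (hg₃ : ‖g₃‖ ≤ 1) (hg₄ : ‖g₄‖ ≤ 1) :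
    ‖f₁ * f₂ * f₃ * f₄ - g₁ * g₂ * g₃ * g₄‖ ≤ ‖f₁ - g₁‖ + ‖f₂ - g₂‖ + ‖f₃ - g₃‖ + ‖f₄ - g₄‖ := by
  have e : f₁ * f₂ * f₃ * f₄ - g₁ * g₂ * g₃ * g₄ =
      f₁ * f₂ * f₃ * (f₄ - g₄) + f₁ * f₂ * (f₃ - g₃) * g₄ + f₁ * (f₂ - g₂) * g₃ * g₄ + (f₁ - g₁) * g₂ * g₃ * g₄ := by noncomm_ring
  rw [e]
  have n3 : ∀ (x y z w : Matrix n n ℂ), ‖x * y * z * w‖ ≤ ‖x‖ * ‖y‖ * ‖z‖ * ‖w‖ := fun x y z w =>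
    (norm_mul_le _ _).trans (mul_le_mul_of_nonneg_right ((norm_mul_le _ _).trans
      (mul_le_mul_of_nonneg_right (norm_mul_le _ _) (norm_nonneg _))) (norm_nonneg _))
  -- `p q r s ≤ s` etc. when three of the four factors are `≤ 1`
  have key : ∀ (p q r t : ℝ), 0 ≤ p → p ≤ 1 → 0 ≤ q → q ≤ 1 → 0 ≤ r → r ≤ 1 → 0 ≤ t → p * q * r * t ≤ t := by
    intro p q r t hp0 hp hq0 hq hr0 hr ht0
    have h1 : p * q ≤ 1 := mul_le_one₀ hp hq0 hq
    have h2 : p * q * r ≤ 1 := mul_le_one₀ h1 hr0 hr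
    exact mul_le_of_le_one_left ht0 h2
  have h4 : ‖f₁ * f₂ * f₃ * (f₄ - g₄)‖ ≤ ‖f₄ - g₄‖ :=
    (n3 _ _ _ _).trans (key _ _ _ _ (norm_nonneg _) hf₁ (norm_nonneg _) hf₂ (norm_nonneg _) hf₃ (norm_nonneg _))
  have h3 : ‖f₁ * f₂ * (f₃ - g₃) * g₄‖ ≤ ‖f₃ - g₃‖ := by
    refine (n3 _ _ _ _).trans ?_
    have := key _ _ _ _ (norm_nonneg f₁) hf₁ (norm_nonneg f₂) hf₂ (norm_nonneg g₄) hg₄ (norm_nonneg (f₃ - g₃))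
    linarith [show ‖f₁‖ * ‖f₂‖ * ‖f₃ - g₃‖ * ‖g₄‖ = ‖f₁‖ * ‖f₂‖ * ‖g₄‖ * ‖f₃ - g₃‖ from by ring]
  have h2 : ‖f₁ * (f₂ - g₂) * g₃ * g₄‖ ≤ ‖f₂ - g₂‖ := by
    refine (n3 _ _ _ _).trans ?_
    have := key _ _ _ _ (norm_nonneg f₁) hf₁ (norm_nonneg g₃) hg₃ (norm_nonneg g₄) hg₄ (norm_nonneg (f₂ - g₂))
    linarith [show ‖f₁‖ * ‖f₂ - g₂‖ * ‖g₃‖ * ‖g₄‖ = ‖f₁‖ * ‖g₃‖ * ‖g₄‖ * ‖f₂ - g₂‖ from by ring]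
  have h1 : ‖(f₁ - g₁) * g₂ * g₃ * g₄‖ ≤ ‖f₁ - g₁‖ := by
    refine (n3 _ _ _ _).trans ?_
    have := key _ _ _ _ (norm_nonneg g₂) hg₂ (norm_nonneg g₃) hg₃ (norm_nonneg g₄) hg₄ (norm_nonneg (f₁ - g₁))
    linarith [show ‖f₁ - g₁‖ * ‖g₂‖ * ‖g₃‖ * ‖g₄‖ = ‖g₂‖ * ‖g₃‖ * ‖g₄‖ * ‖f₁ - g₁‖ from by ring]
  calc _ ≤ ‖f₁ * f₂ * f₃ * (f₄ - g₄)‖ + ‖f₁ * f₂ * (f₃ - g₃) * g₄‖ + ‖f₁ * (f₂ - g₂) * g₃ * g₄‖ + ‖(f₁ - g₁) * g₂ * g₃ * g₄‖ :=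
        (norm_add_le _ _).trans (add_le_add ((norm_add_le _ _).trans (add_le_add (norm_add_le _ _) le_rfl)) le_rfl)
    _ ≤ ‖f₄ - g₄‖ + ‖f₃ - g₃‖ + ‖f₂ - g₂‖ + ‖f₁ - g₁‖ := add_le_add (add_le_add (add_le_add h4 h3) h2) h1
    _ = ‖f₁ - g₁‖ + ‖f₂ - g₂‖ + ‖f₃ - g₃‖ + ‖f₄ - g₄‖ := by ring

/-- **THE PLAQUETTE VARIABLES OF `U` ARE WITHIN `4δ` OF THOSE OF `U₀`** when `‖Y_b‖ ≤ δ` for every bond (`U(∂p) − U₀(∂p)` telescoped over the four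
bond factors, unit norms). [cite: Balaban1985Averaging, (9) p.19] -/
theorem dist1_plaqHol_le_add_of_pertVar (U₀ U : GaugeField P j (Matrix.specialUnitaryGroup n ℂ)) {δ : ℝ}
    (hY : ∀ b, ‖pertVar U₀ U b‖ ≤ δ) (p : Plaq P j) :
    dist1 (GaugeField.plaqHol U p) ≤ dist1 (GaugeField.plaqHol U₀ p) + 4 * δ := by
  rw [FederbushMean.dist1_SU_eq, FederbushMean.dist1_SU_eq]
  have hb : ∀ b : PBond P j, ‖((U b : Matrix.specialUnitaryGroup n ℂ) : Matrix n n ℂ) -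
      ((U₀ b : Matrix.specialUnitaryGroup n ℂ) : Matrix n n ℂ)‖ ≤ δ := fun b => by
    rw [norm_coe_sub_coe_eq_norm_pertVar]; exact hY b
  have hbs : ∀ b : PBond P j, ‖star ((U b : Matrix.specialUnitaryGroup n ℂ) : Matrix n n ℂ) -
      star ((U₀ b : Matrix.specialUnitaryGroup n ℂ) : Matrix n n ℂ)‖ ≤ δ := fun b => by
    rw [← star_sub, norm_star]; exact hb b
  have hn : ∀ g : Matrix.specialUnitaryGroup n ℂ, ‖(g : Matrix n n ℂ)‖ ≤ 1 := fun g =>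
    (CStarRing.norm_of_mem_unitary (coe_mem_unitaryGroup g)).le
  have hns : ∀ g : Matrix.specialUnitaryGroup n ℂ, ‖star (g : Matrix n n ℂ)‖ ≤ 1 := fun g => by
    rw [norm_star]; exact hn g
  unfold GaugeField.plaqHol
  simp only [Submonoid.coe_mul]
  rw [show (((U ⟨p.src.shift p.ν, p.μ⟩)⁻¹ : Matrix.specialUnitaryGroup n ℂ) : Matrix n n ℂ) = star ((U ⟨p.src.shift p.ν, p.μ⟩ : Matrix.specialUnitaryGroup n ℂ) : Matrix n n ℂ) from rfl,
    show (((U ⟨p.src, p.ν⟩)⁻¹ : Matrix.specialUnitaryGroup n ℂ) : Matrix n n ℂ) = star ((U ⟨p.src, p.ν⟩ : Matrix.specialUnitaryGroup n ℂ) : Matrix n n ℂ) from rfl,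
    show (((U₀ ⟨p.src.shift p.ν, p.μ⟩)⁻¹ : Matrix.specialUnitaryGroup n ℂ) : Matrix n n ℂ) = star ((U₀ ⟨p.src.shift p.ν, p.μ⟩ : Matrix.specialUnitaryGroup n ℂ) : Matrix n n ℂ) from rfl,
    show (((U₀ ⟨p.src, p.ν⟩)⁻¹ : Matrix.specialUnitaryGroup n ℂ) : Matrix n n ℂ) = star ((U₀ ⟨p.src, p.ν⟩ : Matrix.specialUnitaryGroup n ℂ) : Matrix n n ℂ) from rfl]
  have e : ∀ X X₀ : Matrix n n ℂ, X - 1 = (X - X₀) + (X₀ - 1) := fun X X₀ => by abel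
  rw [e _ (((U₀ ⟨p.src, p.μ⟩ : Matrix.specialUnitaryGroup n ℂ) : Matrix n n ℂ) *
      ((U₀ ⟨p.src.shift p.μ, p.ν⟩ : Matrix.specialUnitaryGroup n ℂ) : Matrix n n ℂ) *
      star ((U₀ ⟨p.src.shift p.ν, p.μ⟩ : Matrix.specialUnitaryGroup n ℂ) : Matrix n n ℂ) *
      star ((U₀ ⟨p.src, p.ν⟩ : Matrix.specialUnitaryGroup n ℂ) : Matrix n n ℂ))]
  refine (norm_add_le _ _).trans ?_
  have h := norm_prod_four_sub_prod_four_le (hn (U ⟨p.src, p.μ⟩)) (hn (U ⟨p.src.shift p.μ, p.ν⟩)) (hns (U ⟨p.src.shift p.ν, p.μ⟩))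
    (hn (U₀ ⟨p.src.shift p.μ, p.ν⟩)) (hns (U₀ ⟨p.src.shift p.ν, p.μ⟩)) (hns (U₀ ⟨p.src, p.ν⟩))
    (f₄ := star ((U ⟨p.src, p.ν⟩ : Matrix.specialUnitaryGroup n ℂ) : Matrix n n ℂ)) (g₁ := ((U₀ ⟨p.src, p.μ⟩ : Matrix.specialUnitaryGroup n ℂ) : Matrix n n ℂ))
  have h' := h.trans (add_le_add (add_le_add (add_le_add (hb _) (hb _)) (hbs _)) (hbs _))
  linarith

/-- Hence `PlaqSmall a U₀ ⇒ PlaqSmall (a + 4δ) U`. [cite: Balaban1985Averaging, (9) p.19] -/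
theorem plaqSmall_of_pertVar (U₀ U : GaugeField P j (Matrix.specialUnitaryGroup n ℂ)) {δ a : ℝ} (hU₀ : PlaqSmall a U₀)
    (hY : ∀ b, ‖pertVar U₀ U b‖ ≤ δ) : PlaqSmall (a + 4 * δ) U := fun p =>
  (dist1_plaqHol_le_add_of_pertVar U₀ U hY p).trans_lt (by linarith [hU₀ p])

/-- **THE DEFECT OF THE AVERAGE**: under the hypotheses of `norm_avgFun_ratio_sub_one_sub_covLinAvgR0_le_of_plaqSmall` and the linearised constraint
up to `ρ` (`‖(Q₁^{R₀}(U₀)Y)(c)‖ ≤ ρ`), `‖Ū₀(c) − Ū(c)‖ ≤ 404·ℓδ·(ℓδ + (ℓ²/4)a) + ρ`. [cite: Balaban1985Averaging, Prop. 3 (122)-(125) p.36] -/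
theorem norm_avgFun_sub_avgFun_le (U₀ U : GaugeField P j (Matrix.specialUnitaryGroup n ℂ)) {δ a ρ : ℝ}
    (hδ : 0 ≤ δ) (ha : 0 ≤ a) (hU₀ : PlaqSmall a U₀) (hY : ∀ b, ‖pertVar U₀ U b‖ ≤ δ)
    (h48 : 48 * ((((P.d + 2) * P.L : ℕ) : ℝ) * δ) ≤ 1)
    (hα24 : ((((P.d + 2) * P.L : ℕ) : ℝ) ^ 2 / 4) * a ≤ 1 / 24)
    (hN : 2 * ((((P.d + 2) * P.L : ℕ) : ℝ) * δ) + ((((P.d + 2) * P.L : ℕ) : ℝ) ^ 2 / 4) * a < deltaSU n) (c : PBond P (j + 1))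
    (hlin : ‖covLinAvgR0 U₀ (pertVar U₀ U) c‖ ≤ ρ) :
    ‖((avgFun (expMeanLogSU (n := n)) U₀ c : Matrix.specialUnitaryGroup n ℂ) : Matrix n n ℂ) -
        ((avgFun (expMeanLogSU (n := n)) U c : Matrix.specialUnitaryGroup n ℂ) : Matrix n n ℂ)‖ ≤
      404 * ((((P.d + 2) * P.L : ℕ) : ℝ) * δ) * ((((P.d + 2) * P.L : ℕ) : ℝ) * δ + ((((P.d + 2) * P.L : ℕ) : ℝ) ^ 2 / 4) * a) + ρ := by
  have h := norm_avgFun_ratio_sub_one_sub_covLinAvgR0_le_of_plaqSmall U₀ U hδ ha hU₀ hY h48 hα24 hN c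
  have hu : star ((avgFun (expMeanLogSU (n := n)) U₀ c : Matrix.specialUnitaryGroup n ℂ) : Matrix n n ℂ) *
      ((avgFun (expMeanLogSU (n := n)) U₀ c : Matrix.specialUnitaryGroup n ℂ) : Matrix n n ℂ) = 1 :=
    Unitary.star_mul_self_of_mem (coe_mem_unitaryGroup _)
  have key : ∀ (A A₀ Q : Matrix n n ℂ), star A₀ * A₀ = 1 → A₀ - A = -((A * star A₀ - 1 - Q) * A₀ + Q * A₀) := by
    intro A A₀ Q hA₀
    rw [sub_mul, sub_mul, mul_assoc, hA₀, mul_one, one_mul]; abel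
  have e := key ((avgFun (expMeanLogSU (n := n)) U c : Matrix.specialUnitaryGroup n ℂ) : Matrix n n ℂ)
    ((avgFun (expMeanLogSU (n := n)) U₀ c : Matrix.specialUnitaryGroup n ℂ) : Matrix n n ℂ) (covLinAvgR0 U₀ (pertVar U₀ U) c) hu
  have hn1 := CStarRing.norm_mul_mem_unitary
    (((avgFun (expMeanLogSU (n := n)) U c : Matrix.specialUnitaryGroup n ℂ) : Matrix n n ℂ) *
        star ((avgFun (expMeanLogSU (n := n)) U₀ c : Matrix.specialUnitaryGroup n ℂ) : Matrix n n ℂ) - 1 - covLinAvgR0 U₀ (pertVar U₀ U) c)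
    (coe_mem_unitaryGroup (avgFun (expMeanLogSU (n := n)) U₀ c))
  have hn2 := CStarRing.norm_mul_mem_unitary (covLinAvgR0 U₀ (pertVar U₀ U) c) (coe_mem_unitaryGroup (avgFun (expMeanLogSU (n := n)) U₀ c))
  calc ‖((avgFun (expMeanLogSU (n := n)) U₀ c : Matrix.specialUnitaryGroup n ℂ) : Matrix n n ℂ) -
          ((avgFun (expMeanLogSU (n := n)) U c : Matrix.specialUnitaryGroup n ℂ) : Matrix n n ℂ)‖
      = ‖(((avgFun (expMeanLogSU (n := n)) U c : Matrix.specialUnitaryGroup n ℂ) : Matrix n n ℂ) *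
            star ((avgFun (expMeanLogSU (n := n)) U₀ c : Matrix.specialUnitaryGroup n ℂ) : Matrix n n ℂ) - 1 - covLinAvgR0 U₀ (pertVar U₀ U) c) *
            ((avgFun (expMeanLogSU (n := n)) U₀ c : Matrix.specialUnitaryGroup n ℂ) : Matrix n n ℂ) +
          covLinAvgR0 U₀ (pertVar U₀ U) c * ((avgFun (expMeanLogSU (n := n)) U₀ c : Matrix.specialUnitaryGroup n ℂ) : Matrix n n ℂ)‖ := by
        rw [e, norm_neg]
    _ ≤ _ := (norm_add_le _ _).trans (add_le_add (hn1.le.trans h) (hn2.le.trans hlin))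

end Letters

/-- **THE FIBRE THROUGH `U₀` IS A GRAPH OVER THE LINEARISED KERNEL TO SECOND ORDER (one (0.4)-averaging step, d = 3 carrier, `SU(2)`)**: there are
`t₀ > 0` and `C ≥ 0` (the corrector's: `t₀ = (3600(L+1)⁵)⁻¹`, `C = 72L³`) such that for every member `F` of block size `L`, every run `K`, every level
`j + 1 ≤ m + K`, and all `a, δ, ρ ≥ 0` with `48ℓδ ≤ 1`, `(ℓ²/4)a ≤ 1/24`, `2ℓδ + (ℓ²/4)a < δ₂`, `a + 4δ + C·η ≤ t₀` (`ℓ = (d+2)L`,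
`η := 404·ℓδ·(ℓδ + (ℓ²/4)a) + ρ`): if `U₀` has plaquettes within `a` of `1`, `U = (1 + Y)U₀` with `‖Y_b‖ ≤ δ`, and the LINEARISED constraint holds up to
`ρ` (`‖(Q₁^{R₀}(U₀)Y)(c)‖ ≤ ρ` for every coarse bond), then there is `U′` with `Ū′ = Ū₀` EXACTLY, `U′ = U` off the central crossing bonds, `‖U′_b − U_b‖ ≤ Cη`
bondwise, and plaquettes within `a + 4δ + 4Cη` of `1` — print's chart `A = A′ − HD(A′)`, `|D(A′)| ≤ 4C₂|A′|²` for one step in existence form.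
[cite: Balaban1985Variational, Prop. 3 (47)-(48) p.289] -/
theorem exists_fibre_point_near_of_linearised (L : ℕ) : ∃ t₀ C : ℝ, 0 < t₀ ∧ 0 ≤ C ∧
    ∀ F : T3Family, F.L = L → ∀ (K j : ℕ), j + 1 ≤ F.m + K →
      ∀ (a δ ρ : ℝ), 0 ≤ a → 0 ≤ δ → 0 ≤ ρ →
        48 * (((((F.P K).d + 2) * (F.P K).L : ℕ) : ℝ) * δ) ≤ 1 →
        (((((F.P K).d + 2) * (F.P K).L : ℕ) : ℝ) ^ 2 / 4) * a ≤ 1 / 24 →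
        2 * (((((F.P K).d + 2) * (F.P K).L : ℕ) : ℝ) * δ) + (((((F.P K).d + 2) * (F.P K).L : ℕ) : ℝ) ^ 2 / 4) * a < deltaSU (Fin 2) →
        a + 4 * δ + C * (404 * (((((F.P K).d + 2) * (F.P K).L : ℕ) : ℝ) * δ) * (((((F.P K).d + 2) * (F.P K).L : ℕ) : ℝ) * δ +
          (((((F.P K).d + 2) * (F.P K).L : ℕ) : ℝ) ^ 2 / 4) * a) + ρ) ≤ t₀ →
        ∀ U₀ U : GaugeField (F.P K) j (Matrix.specialUnitaryGroup (Fin 2) ℂ), PlaqSmall a U₀ →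
          (∀ b, ‖pertVar U₀ U b‖ ≤ δ) → (∀ c, ‖covLinAvgR0 U₀ (pertVar U₀ U) c‖ ≤ ρ) →
            ∃ U' : GaugeField (F.P K) j (Matrix.specialUnitaryGroup (Fin 2) ℂ),
              avgFun ℰp U' = avgFun ℰp U₀ ∧
              (∀ b, (∀ c, centralBond c ≠ b) → U' b = U b) ∧
              (∀ b, ‖((U' b : Matrix.specialUnitaryGroup (Fin 2) ℂ) : Matrix (Fin 2) (Fin 2) ℂ) - (U b : Matrix (Fin 2) (Fin 2) ℂ)‖ ≤
                C * (404 * (((((F.P K).d + 2) * (F.P K).L : ℕ) : ℝ) * δ) * (((((F.P K).d + 2) * (F.P K).L : ℕ) : ℝ) * δ +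
                  (((((F.P K).d + 2) * (F.P K).L : ℕ) : ℝ) ^ 2 / 4) * a) + ρ)) ∧
              PlaqSmall (a + 4 * δ + 4 * (C * (404 * (((((F.P K).d + 2) * (F.P K).L : ℕ) : ℝ) * δ) *
                (((((F.P K).d + 2) * (F.P K).L : ℕ) : ℝ) * δ + (((((F.P K).d + 2) * (F.P K).L : ℕ) : ℝ) ^ 2 / 4) * a) + ρ))) U' := by
  obtain ⟨t₀, C, ht₀, hC, hcorr⟩ := BlockAvgCorrector.exists_corrector_T3 L
  refine ⟨t₀, C, ht₀, hC, ?_⟩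
  intro F hF K j hj a δ ρ ha hδ hρ h48 hα24 hN hle U₀ U hU₀ hY hlin
  set η : ℝ := 404 * (((((F.P K).d + 2) * (F.P K).L : ℕ) : ℝ) * δ) * (((((F.P K).d + 2) * (F.P K).L : ℕ) : ℝ) * δ +
    (((((F.P K).d + 2) * (F.P K).L : ℕ) : ℝ) ^ 2 / 4) * a) + ρ with hη
  have hℓ0 : 0 ≤ ((((F.P K).d + 2) * (F.P K).L : ℕ) : ℝ) := Nat.cast_nonneg _
  have hη0 : 0 ≤ η := by positivity
  -- the perturbed field is small-plaquette
  have hU : PlaqSmall (a + 4 * δ) U := plaqSmall_of_pertVar U₀ U hU₀ hY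
  -- its average is within `η` of the background's
  have hdef : ∀ c, ‖((avgFun ℰp U₀ c : Matrix.specialUnitaryGroup (Fin 2) ℂ) : Matrix (Fin 2) (Fin 2) ℂ) -
      ((avgFun ℰp U c : Matrix.specialUnitaryGroup (Fin 2) ℂ) : Matrix (Fin 2) (Fin 2) ℂ)‖ ≤ η := fun c =>
    norm_avgFun_sub_avgFun_le U₀ U hδ ha hU₀ hY h48 hα24 hN c (hlin c)
  -- the exact corrector with target `V = Ū₀`
  exact hcorr F hF K j hj (a + 4 * δ) η (by positivity) hη0 hle U hU (avgFun ℰp U₀) hdef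

end Summit.QuantumFields.YangMills.Theorems.Prop7AvgLinearisation

end
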